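import Literature.MathematicalPhysics.PowerSystems.KronReductionClosure
import HarnessLib

/-!
# The reduced network equations of a Kron reduction: `Q_red V_α = I_α + Q_ac I_β` (Kron 1939,
# Ward's equivalent; Dörfler–Bullo 2013 §1) — load-bus injections of the DC power flow are
# transferred to the generator buses by the current-division factors, with conservation

Topic `Literature/MathematicalPhysics/PowerSystems`; namespaces `…PowerSystems.KronReduction` (§1
block form, §2 predicate form) and `…PowerSystems.ClassicalModel` (§3).  Ninth file of the
Dörfler–Bullo Kron-reduction story (`KronReductionClosure` supplies `interiorBlock_posDef_of_laplacian`,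
`kronAccompanying_colsum_eq_one`, `kronAccompanying_nonneg`).  Everything below is PROVED: 0
definitions, 0 named facts, 0 `sorry`, no new axiom.

SOURCE (read on the page; `lit read paper:arxiv-1102.2950` = [DorflerBullo2013] §1, p0003 L28–L50):
«consider the partition … `[I_α; I_β] = [[Q_αα, Q_αβ],[Q_βα, Q_ββ]] [V_α; V_β]`.  Gaussian elimination
of the interior voltages `V_β` … gives an electrically-equivalent reduced network with `|α|` nodes
obeying the reduced current-balances `I_α + Q_ac I_β = Q_red V_α`, where … `Q_red = Q_αα −
Q_αβQ_ββ⁻¹Q_βα`.  The accompanying matrix `Q_ac = −Q_αβQ_ββ⁻¹` maps internal currents to boundary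
currents in the reduced network.  In case that `I_β` is the vector of zeros, the `(i,j)`-element of
`Q_red` is the current at boundary node `i` due to a unit potential at boundary node `j` and a zero
potential at all other boundary nodes.»  §2.1 Lemma 2.1 3) (p0007 L25–L29): `Q_ac ≥ 0`, columns
summing to `1` in the loop-less case (typed in `KronReductionClosure`).

RENDERING.  Block form `[[A, B],[Bᵀ, C]]`, `C ≻ 0`; predicate form `Q : Matrix ι ι ℝ`, boundary
`{i // p i}`, `Q_red` spelled out, `Q_ac` written `−(Q_αβ Q_ββ⁻¹)`; potentials `z : ι → ℝ`, currents
`Qz`.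

WHAT IS PROVED (0 `def`, 0 named facts, 0 `sorry`):
* §1 ★★ `schur_mulVec_eq_currents` (block form: `(A − BC⁻¹Bᵀ)x = (Ax + By) + (−BC⁻¹)(Bᵀx + Cy)`
  for all `x, y`).
* §2 ★★★ **`kronReduced_mulVec_eq_currents`** (`Q_red z|α = (Qz)|α + Q_ac (Qz)|β` for EVERY `z`),
  ★★ `kronReduced_mulVec_of_interior_zero` (`(Qz)|β = 0 ⇒ Q_red z|α = (Qz)|α`), ★★
  `kronReduced_apply_eq_current` (`Q_red[a,a']` = boundary current at `a` of the unit-potential-at-`a'`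
  profile), ★★ `sum_reducedInjection_eq` (loop-less connected `Q`: `Σ_a (I|α + Q_ac I|β)_a = Σ_i I_i`),
  ★ `reducedInjection_nonneg`.
* §3 THE MODEL (`ClassicalModel`, DC power flow `P = Bθ` on a connected lossless grid, generator
  buses = boundary, load buses = interior): ★★★ **`dcFlow_kronReduced`** (WARD EQUIVALENT:
  `B_red θ|α = P|α + B_ac P|β` — load-bus injections are moved to the generator buses with the
  current-division factors `B_ac[a,b] ∈ [0,1]`), ★★★ **`wardInjection_sum_eq`** (shunt-free: total
  transferred injection = total injection; non-negative load injections stay non-negative).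

PROOF ROUTE: block Gaussian elimination (`C⁻¹C = 1`), the splitting of `(Qz)_i` into boundary and
interior sums (`Fintype.sum_subtype_add_sum_subtype`), and the column sums of `Q_ac`.  In-seat exact
cross-check (`negtest/kron_ward_check.py`, python `Fraction`s, seat folder): random connected loopy /
loop-less Laplacians, random boundaries and potentials — the reduced balances, the unit-potential
reading of `Q_red[a,a']`, conservation and non-negativity all pass.

THREE COLUMNS.  CERTIFIED (kernel theorems): for exact symmetric `Q` with `Q_ββ ≻ 0` and every
`z`, `Q_red z|α = (Qz)|α − Q_αβQ_ββ⁻¹(Qz)|β`; entries of `Q_red` as boundary currents; for connected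
loop-less Laplacians the transferred injections sum to the total injection and preserve sign.
MODELLED: DC (linearised, lossless) power flow with constant injections at the eliminated buses.
NOT CLAIMED: nonlinear (AC) power flow, constant-power loads in the swing model (the classical
model's Kron reduction assumes constant-impedance / constant-current loads), dynamics.

## References
* [DorflerBullo2013] F. Dörfler, F. Bullo, *Kron reduction of graphs with applications to electrical
  networks*, IEEE Trans. Circuits Syst. I 60 (2013) 150–163, arXiv:1102.2950 — §1, §2.1 Lemma 2.1 3).
-/

noncomputable section

open scoped Matrix
open Finset Matrix

namespace Literature.MathematicalPhysics.PowerSystems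

namespace KronReduction

/-! ### §1. Block form: Gaussian elimination of the interior potentials -/

section Block

variable {m k : Type*} [Fintype m] [Fintype k] [DecidableEq m] [DecidableEq k]

omit [DecidableEq m] in
/-- ★★ **THE REDUCED CURRENT BALANCES, block form** («Gaussian elimination of the interior voltages
`V_β` in `I = QV` gives … `I_α + Q_ac I_β = Q_red V_α`», `Q_ac = −Q_αβQ_ββ⁻¹`): for `C ≻ 0` and ANY
potentials `x` (boundary), `y` (interior), with the currents `I_α = Ax + By`, `I_β = Bᵀx + Cy`:
`(A − BC⁻¹Bᵀ)x = I_α + (−BC⁻¹) I_β`.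
[cite: DorflerBullo2013, §1 eqs. (network equations partitioned), (reduced current-balances) (arXiv:1102.2950 p0003 L28–L48)] -/
theorem schur_mulVec_eq_currents (A : Matrix m m ℝ) (B : Matrix m k ℝ) {C : Matrix k k ℝ}
    (hC : C.PosDef) (x : m → ℝ) (y : k → ℝ) :
    (A - B * C⁻¹ * Bᵀ) *ᵥ x
      = (A *ᵥ x + B *ᵥ y) + (-(B * C⁻¹)) *ᵥ (Bᵀ *ᵥ x + C *ᵥ y) := by
  have hCu : IsUnit C.det := (Matrix.isUnit_iff_isUnit_det _).1 hC.isUnit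
  rw [Matrix.sub_mulVec, Matrix.neg_mulVec, Matrix.mulVec_add, Matrix.mulVec_mulVec,
    Matrix.mulVec_mulVec, Matrix.mul_assoc B C⁻¹ C, Matrix.nonsing_inv_mul _ hCu, Matrix.mul_one]
  abel

end Block

/-! ### §2. Predicate form: `Q_red V_α = I_α + Q_ac I_β` for every potential profile, the entries
of `Q_red` as boundary currents, conservation of the transferred current -/

section Predicate

variable {ι : Type*} [Fintype ι] [DecidableEq ι]

omit [Fintype ι] [DecidableEq ι] in
/-- Symmetric entries. [folklore] -/
private theorem entry_symm₇ {Q : Matrix ι ι ℝ} (hQ : Q.IsHermitian) (i j : ι) : Q j i = Q i j := by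
  simpa only [star_trivial] using hQ.apply i j

omit [Fintype ι] [DecidableEq ι] in
/-- The lower-left block is the transpose of the upper-right one. [folklore] -/
private theorem submatrix_swap_eq_transpose₇ (p : ι → Prop) {Q : Matrix ι ι ℝ}
    (hQ : Q.IsHermitian) : Q.submatrix (Subtype.val : {v : ι // ¬ (p v)} → ι) (Subtype.val : {v : ι // p v} → ι) = (Q.submatrix (Subtype.val : {v : ι // p v} → ι) (Subtype.val : {v : ι // ¬ (p v)} → ι))ᵀ := by
  ext b a
  simp [entry_symm₇ hQ (a : ι) (b : ι)]

omit [DecidableEq ι] in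
/-- Splitting `(Qz)_i` into boundary and interior contributions. [folklore] -/
private theorem mulVec_split (p : ι → Prop) [DecidablePred p] (Q : Matrix ι ι ℝ) (z : ι → ℝ)
    (i : ι) :
    (Q *ᵥ z) i = ∑ a : {v // p v}, Q i a * z a + ∑ b : {v // ¬ p v}, Q i b * z b := by
  rw [Matrix.mulVec, dotProduct, ← Fintype.sum_subtype_add_sum_subtype p (fun j => Q i j * z j)]

omit [DecidableEq ι] in
/-- Boundary rows of `Qz` in block form. [folklore] -/
private theorem mulVec_boundary (p : ι → Prop) [DecidablePred p] (Q : Matrix ι ι ℝ) (z : ι → ℝ) :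
    (fun a : {v // p v} => (Q *ᵥ z) a)
      = Q.submatrix (Subtype.val : {v : ι // p v} → ι) (Subtype.val : {v : ι // p v} → ι) *ᵥ (fun a : {v // p v} => z a) + Q.submatrix (Subtype.val : {v : ι // p v} → ι) (Subtype.val : {v : ι // ¬ (p v)} → ι) *ᵥ (fun b : {v // ¬ p v} => z b) := by
  ext a
  rw [mulVec_split p Q z a]
  simp [Matrix.mulVec, dotProduct]

omit [DecidableEq ι] in
/-- Interior rows of `Qz` in block form. [folklore] -/
private theorem mulVec_interior (p : ι → Prop) [DecidablePred p] (Q : Matrix ι ι ℝ) (z : ι → ℝ) :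
    (fun b : {v // ¬ p v} => (Q *ᵥ z) b)
      = Q.submatrix (Subtype.val : {v : ι // ¬ (p v)} → ι) (Subtype.val : {v : ι // p v} → ι) *ᵥ (fun a : {v // p v} => z a) + Q.submatrix (Subtype.val : {v : ι // ¬ (p v)} → ι) (Subtype.val : {v : ι // ¬ (p v)} → ι) *ᵥ (fun b : {v // ¬ p v} => z b) := by
  ext b
  rw [mulVec_split p Q z b]
  simp [Matrix.mulVec, dotProduct]

/-- ★★★ **THE REDUCED NETWORK EQUATIONS** (Kron 1939 / Ward's equivalent; D–B §1): `Q` symmetric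
with `Q_ββ ≻ 0`.  For EVERY potential profile `z` with currents `I = Qz`, the boundary potentials
satisfy the reduced current balances `Q_red z|α = I|α + Q_ac I|β`, `Q_ac = −Q_αβQ_ββ⁻¹` («the
accompanying matrix maps internal currents to boundary currents in the reduced network»).
[cite: DorflerBullo2013, §1 eqs. (network equations partitioned), (reduced current-balances) and the sentence after them (arXiv:1102.2950 p0003 L28–L50)] -/
theorem kronReduced_mulVec_eq_currents (p : ι → Prop) [DecidablePred p] {Q : Matrix ι ι ℝ}
    (hQ : Q.IsHermitian) (hC : (Q.submatrix (Subtype.val : {v : ι // ¬ (p v)} → ι) (Subtype.val : {v : ι // ¬ (p v)} → ι)).PosDef) (z : ι → ℝ) :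
    (Q.submatrix (Subtype.val : {v : ι // p v} → ι) (Subtype.val : {v : ι // p v} → ι)
        - Q.submatrix (Subtype.val : {v : ι // p v} → ι) (Subtype.val : {v : ι // ¬ (p v)} → ι)
          * (Q.submatrix (Subtype.val : {v : ι // ¬ (p v)} → ι) (Subtype.val : {v : ι // ¬ (p v)} → ι))⁻¹
          * Q.submatrix (Subtype.val : {v : ι // ¬ (p v)} → ι) (Subtype.val : {v : ι // p v} → ι)) *ᵥ (fun a : {v // p v} => z a)
      = (fun a : {v // p v} => (Q *ᵥ z) a)
        + (-(Q.submatrix (Subtype.val : {v : ι // p v} → ι) (Subtype.val : {v : ι // ¬ (p v)} → ι)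
            * (Q.submatrix (Subtype.val : {v : ι // ¬ (p v)} → ι) (Subtype.val : {v : ι // ¬ (p v)} → ι))⁻¹)) *ᵥ (fun b : {v // ¬ p v} => (Q *ᵥ z) b) := by
  rw [mulVec_boundary p Q z, mulVec_interior p Q z, submatrix_swap_eq_transpose₇ p hQ]
  exact schur_mulVec_eq_currents _ _ hC _ _

/-- ★★ **No interior injections: `Q_red` acts on the boundary values as `Q` does** — if
`(Qz)_b = 0` at every interior node then `(Q_red z|α)_a = (Qz)_a`.
[cite: DorflerBullo2013, §1 (reduced current-balances) with `I_β = 0` (arXiv:1102.2950 p0003 L38–L50)] -/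
theorem kronReduced_mulVec_of_interior_zero (p : ι → Prop) [DecidablePred p] {Q : Matrix ι ι ℝ}
    (hQ : Q.IsHermitian) (hC : (Q.submatrix (Subtype.val : {v : ι // ¬ (p v)} → ι) (Subtype.val : {v : ι // ¬ (p v)} → ι)).PosDef) {z : ι → ℝ}
    (hharm : ∀ b : {v // ¬ p v}, (Q *ᵥ z) b = 0) (a : {v // p v}) :
    ((Q.submatrix (Subtype.val : {v : ι // p v} → ι) (Subtype.val : {v : ι // p v} → ι)
        - Q.submatrix (Subtype.val : {v : ι // p v} → ι) (Subtype.val : {v : ι // ¬ (p v)} → ι)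
          * (Q.submatrix (Subtype.val : {v : ι // ¬ (p v)} → ι) (Subtype.val : {v : ι // ¬ (p v)} → ι))⁻¹
          * Q.submatrix (Subtype.val : {v : ι // ¬ (p v)} → ι) (Subtype.val : {v : ι // p v} → ι)) *ᵥ (fun a : {v // p v} => z a)) a = (Q *ᵥ z) a := by
  have h := congrFun (kronReduced_mulVec_eq_currents p hQ hC z) a
  have h0 : (fun b : {v // ¬ p v} => (Q *ᵥ z) b) = 0 := funext hharm
  rw [h0, Matrix.mulVec_zero] at h
  simpa using h

/-- ★★ **THE ENTRIES OF `Q_red` ARE BOUNDARY CURRENTS**: «the `(i,j)`-element of `Q_red` is the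
current at boundary node `i` due to a unit potential at boundary node `j` and a zero potential at all
other boundary nodes» (no interior injections): if `z|α = e_{a'}` and `(Qz)|β = 0` then
`Q_red[a,a'] = (Qz)_a`.
[cite: DorflerBullo2013, §1, sentence after eq. (reduced current-balances) (arXiv:1102.2950 p0003 L48–L50)] -/
theorem kronReduced_apply_eq_current (p : ι → Prop) [DecidablePred p] {Q : Matrix ι ι ℝ}
    (hQ : Q.IsHermitian) (hC : (Q.submatrix (Subtype.val : {v : ι // ¬ (p v)} → ι) (Subtype.val : {v : ι // ¬ (p v)} → ι)).PosDef) {z : ι → ℝ} {a' : {v // p v}}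
    (hz : ∀ a : {v // p v}, z a = (Pi.single a' (1 : ℝ) : {v // p v} → ℝ) a)
    (hharm : ∀ b : {v // ¬ p v}, (Q *ᵥ z) b = 0) (a : {v // p v}) :
    (Q.submatrix (Subtype.val : {v : ι // p v} → ι) (Subtype.val : {v : ι // p v} → ι)
        - Q.submatrix (Subtype.val : {v : ι // p v} → ι) (Subtype.val : {v : ι // ¬ (p v)} → ι)
          * (Q.submatrix (Subtype.val : {v : ι // ¬ (p v)} → ι) (Subtype.val : {v : ι // ¬ (p v)} → ι))⁻¹
          * Q.submatrix (Subtype.val : {v : ι // ¬ (p v)} → ι) (Subtype.val : {v : ι // p v} → ι)) a a' = (Q *ᵥ z) a := by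
  rw [← kronReduced_mulVec_of_interior_zero p hQ hC hharm a]
  have hz' : (fun a : {v // p v} => z a) = Pi.single a' 1 := funext hz
  rw [hz', Matrix.mulVec_single_one]
  rfl

/-- ★★ **CONSERVATION OF THE TRANSFERRED CURRENT (loop-less case)**: for a connected loop-less
Laplacian `Q` (zero row sums) the accompanying matrix is column-stochastic
(`KronReductionClosure.kronAccompanying_colsum_eq_one`), so the total reduced injection equals the
total injection: `Σ_a (I|α + Q_ac I|β)_a = Σ_i I_i` for every current vector `I`.
[cite: DorflerBullo2013, §1 (reduced current-balances) (arXiv:1102.2950 p0003 L38–L50); §2.1 Lemma 2.1 3) («each column sum of `Q_ac` equals 1») (p0007 L27–L29)] -/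
theorem sum_reducedInjection_eq (p : ι → Prop) [DecidablePred p] {Q : Matrix ι ι ℝ}
    (hQ : Q.IsHermitian) (hZ : ∀ i j, i ≠ j → Q i j ≤ 0) (hrow0 : ∀ i, ∑ j, Q i j = 0)
    {G : SimpleGraph ι} (hG : ∀ i j, G.Adj i j ↔ i ≠ j ∧ Q i j ≠ 0) (hconn : G.Connected)
    (hα : ∃ i, p i) (I : ι → ℝ) :
    ∑ a : {v // p v}, ((fun a : {v // p v} => I a) + (-(Q.submatrix (Subtype.val : {v : ι // p v} → ι) (Subtype.val : {v : ι // ¬ (p v)} → ι)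
            * (Q.submatrix (Subtype.val : {v : ι // ¬ (p v)} → ι) (Subtype.val : {v : ι // ¬ (p v)} → ι))⁻¹)) *ᵥ (fun b : {v // ¬ p v} => I b)) a
      = ∑ i, I i := by
  have hcol := kronAccompanying_colsum_eq_one p hQ hZ hrow0 hG hconn hα
  rw [← Fintype.sum_subtype_add_sum_subtype p I]
  simp only [Pi.add_apply, Finset.sum_add_distrib]
  congr 1
  simp only [Matrix.mulVec, dotProduct]
  rw [Finset.sum_comm]
  refine Finset.sum_congr rfl fun b _ => ?_
  rw [← Finset.sum_mul, hcol b, one_mul]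

/-- ★ **… and each interior injection is split among the boundary nodes in NON-NEGATIVE shares**
(`Q_ac ≥ 0`, `KronReductionClosure.kronAccompanying_nonneg`): a non-negative interior injection
vector is transferred to non-negative boundary injections.
[cite: DorflerBullo2013, §2.1 Lemma 2.1 3) («`Q_ac` is nonnegative») (arXiv:1102.2950 p0007 L25–L27)] -/
theorem reducedInjection_nonneg (p : ι → Prop) [DecidablePred p] {Q : Matrix ι ι ℝ}
    (hQ : Q.IsHermitian) (hZ : ∀ i j, i ≠ j → Q i j ≤ 0) (hrow : ∀ i, 0 ≤ ∑ j, Q i j)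
    {G : SimpleGraph ι} (hG : ∀ i j, G.Adj i j ↔ i ≠ j ∧ Q i j ≠ 0) (hconn : G.Connected)
    (hα : ∃ i, p i) {J : {v // ¬ p v} → ℝ} (hJ : ∀ b, 0 ≤ J b) (a : {v // p v}) :
    0 ≤ ((-(Q.submatrix (Subtype.val : {v : ι // p v} → ι) (Subtype.val : {v : ι // ¬ (p v)} → ι)
            * (Q.submatrix (Subtype.val : {v : ι // ¬ (p v)} → ι) (Subtype.val : {v : ι // ¬ (p v)} → ι))⁻¹)) *ᵥ J) a := by
  have hnn := kronAccompanying_nonneg p hQ hZ hrow hG hconn hα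
  simp only [Matrix.mulVec, dotProduct]
  exact Finset.sum_nonneg fun b _ => mul_nonneg (hnn a b) (hJ b)

end Predicate

end KronReduction

/-! ### §3. THE MODEL: the Ward equivalent of the DC power flow — load-bus injections are
transferred to the generator buses by the current-division factors -/

namespace ClassicalModel

open KronReduction

variable {ι : Type*} [Fintype ι] [DecidableEq ι]

/-- ★★★ **WARD EQUIVALENT OF THE DC POWER FLOW.**  `B` the susceptance loopy Laplacian of a
connected lossless network (`hB hZ hrow hG hconn`), generator buses = boundary `α ≠ ∅`, load buses =
interior; `θ` ANY angle profile and `P = Bθ` its DC power-flow injections.  Then the generator angles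
solve the REDUCED DC power flow `B_red θ|α = P|α + B_ac P|β`: every load-bus injection `P_b` is
transferred to the generator buses with the current-division factors `B_ac[a,b]`
(`B_ac = −B_αβB_ββ⁻¹ ≥ 0`, columns summing to `1` for a shunt-free grid — `KronReductionClosure`).
CERTIFIED: kernel identity for exact data; MODELLED: DC (linearised, lossless) power flow, constant
injections at the load buses.
[cite: DorflerBullo2013, §1 eqs. (network equations partitioned), (reduced current-balances), «the accompanying matrix … maps internal currents to boundary currents in the reduced network» (arXiv:1102.2950 p0003 L28–L50); §2.1 Lemma 2.1 3) (p0007 L25–L29)] -/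
theorem dcFlow_kronReduced (p : ι → Prop) [DecidablePred p] {B : Matrix ι ι ℝ}
    (hB : B.IsHermitian) (hZ : ∀ i j, i ≠ j → B i j ≤ 0) (hrow : ∀ i, 0 ≤ ∑ j, B i j)
    {G : SimpleGraph ι} (hG : ∀ i j, G.Adj i j ↔ i ≠ j ∧ B i j ≠ 0) (hconn : G.Connected)
    (hα : ∃ i, p i) (θ : ι → ℝ) :
    (B.submatrix (Subtype.val : {v : ι // p v} → ι) (Subtype.val : {v : ι // p v} → ι)
        - B.submatrix (Subtype.val : {v : ι // p v} → ι) (Subtype.val : {v : ι // ¬ (p v)} → ι)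
          * (B.submatrix (Subtype.val : {v : ι // ¬ (p v)} → ι) (Subtype.val : {v : ι // ¬ (p v)} → ι))⁻¹
          * B.submatrix (Subtype.val : {v : ι // ¬ (p v)} → ι) (Subtype.val : {v : ι // p v} → ι)) *ᵥ (fun a : {v // p v} => θ a)
      = (fun a : {v // p v} => (B *ᵥ θ) a)
        + (-(B.submatrix (Subtype.val : {v : ι // p v} → ι) (Subtype.val : {v : ι // ¬ (p v)} → ι)
            * (B.submatrix (Subtype.val : {v : ι // ¬ (p v)} → ι) (Subtype.val : {v : ι // ¬ (p v)} → ι))⁻¹)) *ᵥ (fun b : {v // ¬ p v} => (B *ᵥ θ) b) :=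
  kronReduced_mulVec_eq_currents p hB (interiorBlock_posDef_of_laplacian p hB hZ hrow hG hconn hα) θ

/-- ★★★ **… WITH CONSERVATION OF THE TRANSFERRED POWER** (shunt-free grid: zero row sums): the
total injection seen by the generator buses in the Ward equivalent equals the total injection of the
full network, `Σ_a (P|α + B_ac P|β)_a = Σ_i P_i`, for every injection vector `P`; and non-negative
load-bus injections are transferred as non-negative generator-bus injections.
[cite: DorflerBullo2013, §1 (reduced current-balances) (arXiv:1102.2950 p0003 L38–L50); §2.1 Lemma 2.1 3) (p0007 L25–L29)] -/
theorem wardInjection_sum_eq (p : ι → Prop) [DecidablePred p] {B : Matrix ι ι ℝ}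
    (hB : B.IsHermitian) (hZ : ∀ i j, i ≠ j → B i j ≤ 0) (hrow0 : ∀ i, ∑ j, B i j = 0)
    {G : SimpleGraph ι} (hG : ∀ i j, G.Adj i j ↔ i ≠ j ∧ B i j ≠ 0) (hconn : G.Connected)
    (hα : ∃ i, p i) (P : ι → ℝ) :
    ∑ a : {v // p v}, ((fun a : {v // p v} => P a) + (-(B.submatrix (Subtype.val : {v : ι // p v} → ι) (Subtype.val : {v : ι // ¬ (p v)} → ι)
            * (B.submatrix (Subtype.val : {v : ι // ¬ (p v)} → ι) (Subtype.val : {v : ι // ¬ (p v)} → ι))⁻¹)) *ᵥ (fun b : {v // ¬ p v} => P b)) a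
        = ∑ i, P i
      ∧ ((∀ b : {v // ¬ p v}, 0 ≤ P b) → ∀ a : {v // p v}, 0 ≤ ((-(B.submatrix (Subtype.val : {v : ι // p v} → ι) (Subtype.val : {v : ι // ¬ (p v)} → ι)
            * (B.submatrix (Subtype.val : {v : ι // ¬ (p v)} → ι) (Subtype.val : {v : ι // ¬ (p v)} → ι))⁻¹)) *ᵥ (fun b : {v // ¬ p v} => P b)) a) :=
  ⟨sum_reducedInjection_eq p hB hZ hrow0 hG hconn hα P,
    fun hP => reducedInjection_nonneg p hB hZ (fun i => (hrow0 i).symm.le) hG hconn hα hP⟩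

end ClassicalModel

end Literature.MathematicalPhysics.PowerSystems
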